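import Summits.Ventures.PercRepro.RankLevelSetExplicitLinArithA

/-!
# PercRepro — THE ARITHMETIC OF THEOREM P⁗′, PART B: THE TERM BOUNDS AT `p ≥ Tlin q = 20·q·2^q` AND THE POLYNOMIAL
INEQUALITY `(P_d)` UNDER LEMMA T_k (p9, S4)

`proofs/SUBCLAIM-S4-p9.md` §S4.2⁗. The bounds (S3) (Lemma T), (S4) (Lemma T4) and (B) (the big class) of
`RankLevelSetExplicitMultArithB`, re-proved from `p ≥ Tlin q` alone (they only used `p ≥ 20q·2^q`, `16q·2^q`,
`6(q+2)·2^q`), and `poly_main_lin`: with the tail of the small class bounded through LEMMA T_k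
(`C(2d+2q−2, 4)·C(2d+2q−6+n, q−4)` in place of `C(d+q, 5)·C(d+q−5+n, q−4)`, `small_five_bound_lin`),
`8·(C(n,q) + W_s·A + W_b·B) ≤ 7·2^{d−q}·C(p+q, q)` at every corank `q + 1 ≤ d ≤ q + 2^q` for `p ≥ 20·q·2^q`.
Axioms: standard.
-/

namespace PercRepro

namespace ThmN

namespace Explicit

/-- **(S3) the `k = 3` term (Lemma T)**: `96·2^q·d(d+1)·C(p+d, q−2) ≤ 10·μ·C(p+q, q)` for `p ≥ Tlin q`,
`μ = min (2^{q−1} − q) d`. -/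
theorem small_three_bound_lin (q d p μ : ℕ) (hq : 4 ≤ q) (hd1 : q + 1 ≤ d) (hd2 : d ≤ q + 2 ^ q)
    (hp : Tlin q ≤ p) (hμ : μ = min (2 ^ (q - 1) - q) d) :
    96 * 2 ^ q * (d * (d + 1)) * (p + d).choose (q - 2) ≤ 10 * μ * (p + q).choose q := by
  obtain ⟨hy, hz, hqy, hqz⟩ := two_pow_facts q hq
  obtain ⟨hp2, -, -, hp1⟩ := p_lin_bounds q p hq hp
  obtain ⟨-, h16, -, -, -⟩ := Tlin_bounds q hq
  have hx := succ_le_two_pow q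
  -- the ratio bound and two levels down
  have h2 : (p + d).choose (q - 2) ≤ 2 * (p + q).choose (q - 2) := by
    have hside : 2 * (q - 2) * (d - q - 1 + 1) ≤ 16 * q * 2 ^ q := by
      have := Nat.mul_le_mul (show q - 2 ≤ q by omega) (show d - q - 1 + 1 ≤ 2 ^ q by omega)
      nlinarith
    have := choose_le_two_mul_choose (q - 2) (d - q - 1) (p + 2) (by have := h16.trans hp; omega)
    rwa [show p + 2 + (q - 2) + 1 + (d - q - 1) = p + d by omega, show p + 2 + (q - 2) = p + q by omega] at this
  have hdown := two_down p q (by omega)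
  -- the key polynomial inequality
  have hkey : 192 * 2 ^ q * (d * (d + 1)) * (q * (q - 1)) ≤ 10 * μ * p ^ 2 := by
    have hq1 : q * (q - 1) ≤ q ^ 2 := by nlinarith [Nat.sub_le q 1]
    rcases le_total d (2 ^ (q - 1) - q) with hc | hc
    · -- regime (i): `μ = d`, `d + 1 ≤ 2^{q−1}`
      rw [hμ, min_eq_right hc]
      have hd : d + 1 ≤ 2 ^ (q - 1) := by omega
      calc 192 * 2 ^ q * (d * (d + 1)) * (q * (q - 1)) ≤ 192 * 2 ^ q * (d * 2 ^ (q - 1)) * q ^ 2 :=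
            Nat.mul_le_mul (Nat.mul_le_mul_left _ (Nat.mul_le_mul_left _ hd)) hq1
        _ = 96 * d * q ^ 2 * (2 ^ q * (2 * 2 ^ (q - 1))) := by ring
        _ = 96 * (d * q ^ 2 * (2 ^ q) ^ 2) := by rw [hy]; ring
        _ ≤ 4000 * (d * q ^ 2 * (2 ^ q) ^ 2) := Nat.mul_le_mul_right _ (by norm_num)
        _ = 10 * d * (400 * q ^ 2 * (2 ^ q) ^ 2) := by ring
        _ ≤ 10 * d * p ^ 2 := Nat.mul_le_mul_left _ hp2
    · -- regime (ii): `μ = 2^{q−1} − q ≥ 2^{q−2}`, `d + 1 ≤ 2^{q+1}`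
      rw [hμ, min_eq_left hc]
      have hμz : 2 ^ (q - 2) ≤ 2 ^ (q - 1) - q := by omega
      have hd : d + 1 ≤ 2 * 2 ^ q := by omega
      calc 192 * 2 ^ q * (d * (d + 1)) * (q * (q - 1))
          ≤ 192 * 2 ^ q * ((2 * 2 ^ q) * (2 * 2 ^ q)) * q ^ 2 :=
            Nat.mul_le_mul (Nat.mul_le_mul_left _ (Nat.mul_le_mul (by omega) hd)) hq1
        _ = 3072 * (2 ^ (q - 2) * q ^ 2 * (2 ^ q) ^ 2) := by rw [← hz]; ring
        _ ≤ 4000 * (2 ^ (q - 2) * q ^ 2 * (2 ^ q) ^ 2) := Nat.mul_le_mul_right _ (by norm_num)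
        _ = 10 * 2 ^ (q - 2) * (400 * q ^ 2 * (2 ^ q) ^ 2) := by ring
        _ ≤ 10 * 2 ^ (q - 2) * p ^ 2 := Nat.mul_le_mul_left _ hp2
        _ ≤ 10 * (2 ^ (q - 1) - q) * p ^ 2 := Nat.mul_le_mul_right _ (Nat.mul_le_mul_left _ hμz)
  -- assemble and cancel `p²`
  have hpos : 0 < p ^ 2 := by positivity
  apply Nat.le_of_mul_le_mul_right _ hpos
  calc 96 * 2 ^ q * (d * (d + 1)) * (p + d).choose (q - 2) * p ^ 2
      ≤ 96 * 2 ^ q * (d * (d + 1)) * (2 * (p + q).choose (q - 2)) * p ^ 2 :=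
        Nat.mul_le_mul_right _ (Nat.mul_le_mul_left _ h2)
    _ = 192 * 2 ^ q * (d * (d + 1)) * (p ^ 2 * (p + q).choose (q - 2)) := by ring
    _ ≤ 192 * 2 ^ q * (d * (d + 1)) * (q * (q - 1) * (p + q).choose q) := Nat.mul_le_mul_left _ hdown
    _ = (192 * 2 ^ q * (d * (d + 1)) * (q * (q - 1))) * (p + q).choose q := by ring
    _ ≤ (10 * μ * p ^ 2) * (p + q).choose q := Nat.mul_le_mul_right _ hkey
    _ = 10 * μ * (p + q).choose q * p ^ 2 := by ring

/-- **(S4) the `k = 4` term (Lemma T4)**: `64·2^q·d(d+1)(d+2)·C(p+d, q−3) ≤ 10·μ·C(p+q, q)`. -/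
theorem small_four_bound_lin (q d p μ : ℕ) (hq : 4 ≤ q) (hd1 : q + 1 ≤ d) (hd2 : d ≤ q + 2 ^ q)
    (hp : Tlin q ≤ p) (hμ : μ = min (2 ^ (q - 1) - q) d) :
    64 * 2 ^ q * (d * (d + 1) * (d + 2)) * (p + d).choose (q - 3) ≤ 10 * μ * (p + q).choose q := by
  obtain ⟨hy, hz, hqy, hqz⟩ := two_pow_facts q hq
  obtain ⟨-, hp3, -, hp1⟩ := p_lin_bounds q p hq hp
  obtain ⟨-, h16, -, -, -⟩ := Tlin_bounds q hq
  have hx := succ_le_two_pow q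
  have h2 : (p + d).choose (q - 3) ≤ 2 * (p + q).choose (q - 3) := by
    have hside : 2 * (q - 3) * (d - q - 1 + 1) ≤ 16 * q * 2 ^ q := by
      have := Nat.mul_le_mul (show q - 3 ≤ q by omega) (show d - q - 1 + 1 ≤ 2 ^ q by omega)
      nlinarith
    have := choose_le_two_mul_choose (q - 3) (d - q - 1) (p + 3) (by have := h16.trans hp; omega)
    rwa [show p + 3 + (q - 3) + 1 + (d - q - 1) = p + d by omega, show p + 3 + (q - 3) = p + q by omega] at this
  have hdown := three_down p q (by omega)
  have hkey : 128 * 2 ^ q * (d * (d + 1) * (d + 2)) * (q * (q - 1) * (q - 2)) ≤ 10 * μ * p ^ 3 := by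
    have hq1 : q * (q - 1) * (q - 2) ≤ q ^ 3 := by
      calc q * (q - 1) * (q - 2) ≤ q * q * q :=
            Nat.mul_le_mul (Nat.mul_le_mul le_rfl (Nat.sub_le q 1)) (Nat.sub_le q 2)
        _ = q ^ 3 := by ring
    rcases le_total d (2 ^ (q - 1) - q) with hc | hc
    · rw [hμ, min_eq_right hc]
      have hd : d + 2 ≤ 2 ^ (q - 1) := by omega
      calc 128 * 2 ^ q * (d * (d + 1) * (d + 2)) * (q * (q - 1) * (q - 2))
          ≤ 128 * 2 ^ q * (d * 2 ^ (q - 1) * 2 ^ (q - 1)) * q ^ 3 :=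
            Nat.mul_le_mul (Nat.mul_le_mul_left _ (Nat.mul_le_mul (Nat.mul_le_mul_left _ (by omega)) hd)) hq1
        _ = 32 * d * q ^ 3 * (2 ^ q * ((2 * 2 ^ (q - 1)) * (2 * 2 ^ (q - 1)))) := by ring
        _ = 32 * (d * q ^ 3 * (2 ^ q) ^ 3) := by rw [hy]; ring
        _ ≤ 80000 * (d * q ^ 3 * (2 ^ q) ^ 3) := Nat.mul_le_mul_right _ (by norm_num)
        _ = 10 * d * (8000 * q ^ 3 * (2 ^ q) ^ 3) := by ring
        _ ≤ 10 * d * p ^ 3 := Nat.mul_le_mul_left _ hp3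
    · rw [hμ, min_eq_left hc]
      have hμz : 2 ^ (q - 2) ≤ 2 ^ (q - 1) - q := by omega
      have hd : d + 2 ≤ 2 * 2 ^ q := by omega
      calc 128 * 2 ^ q * (d * (d + 1) * (d + 2)) * (q * (q - 1) * (q - 2))
          ≤ 128 * 2 ^ q * ((2 * 2 ^ q) * (2 * 2 ^ q) * (2 * 2 ^ q)) * q ^ 3 :=
            Nat.mul_le_mul (Nat.mul_le_mul_left _ (Nat.mul_le_mul (Nat.mul_le_mul (by omega) (by omega)) hd)) hq1
        _ = 4096 * (2 ^ (q - 2) * q ^ 3 * (2 ^ q) ^ 3) := by rw [← hz]; ring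
        _ ≤ 80000 * (2 ^ (q - 2) * q ^ 3 * (2 ^ q) ^ 3) := Nat.mul_le_mul_right _ (by norm_num)
        _ = 10 * 2 ^ (q - 2) * (8000 * q ^ 3 * (2 ^ q) ^ 3) := by ring
        _ ≤ 10 * 2 ^ (q - 2) * p ^ 3 := Nat.mul_le_mul_left _ hp3
        _ ≤ 10 * (2 ^ (q - 1) - q) * p ^ 3 := Nat.mul_le_mul_right _ (Nat.mul_le_mul_left _ hμz)
  have hpos : 0 < p ^ 3 := by positivity
  apply Nat.le_of_mul_le_mul_right _ hpos
  calc 64 * 2 ^ q * (d * (d + 1) * (d + 2)) * (p + d).choose (q - 3) * p ^ 3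
      ≤ 64 * 2 ^ q * (d * (d + 1) * (d + 2)) * (2 * (p + q).choose (q - 3)) * p ^ 3 :=
        Nat.mul_le_mul_right _ (Nat.mul_le_mul_left _ h2)
    _ = 128 * 2 ^ q * (d * (d + 1) * (d + 2)) * (p ^ 3 * (p + q).choose (q - 3)) := by ring
    _ ≤ 128 * 2 ^ q * (d * (d + 1) * (d + 2)) * (q * (q - 1) * (q - 2) * (p + q).choose q) :=
        Nat.mul_le_mul_left _ hdown
    _ = (128 * 2 ^ q * (d * (d + 1) * (d + 2)) * (q * (q - 1) * (q - 2))) * (p + q).choose q := by ring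
    _ ≤ (10 * μ * p ^ 3) * (p + q).choose q := Nat.mul_le_mul_right _ hkey
    _ = 10 * μ * (p + q).choose q * p ^ 3 := by ring

/-- `X = d + q − 3 + (q+1)d ≤ (q+2)(d+q)`. -/
theorem big_arg_le_lin (q d : ℕ) (hq : 4 ≤ q) :
    d + q - 3 + (q + 1) * d ≤ (q + 2) * (d + q) := by
  have h1 : q ≤ (q + 2) * q := by nlinarith
  calc d + q - 3 + (q + 1) * d ≤ d + q + (q + 1) * d := by omega
    _ = (q + 2) * d + q := by ring
    _ ≤ (q + 2) * d + (q + 2) * q := by omega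
    _ = (q + 2) * (d + q) := by ring

/-- **(B) the big class**: `32·2^q·C(d+q, 3)·C(d+q−3+(q+1)d, q−2) ≤ 5·d·C(p+q, q)` for `p ≥ Tlin q`. -/
theorem big_class_bound_lin (q d p : ℕ) (hq : 4 ≤ q) (hd1 : q + 1 ≤ d) (hd2 : d ≤ q + 2 ^ q)
    (hp : Tlin q ≤ p) :
    32 * 2 ^ q * ((d + q).choose 3 * (d + q - 3 + (q + 1) * d).choose (q - 2)) ≤ 5 * d * (p + q).choose q := by
  obtain ⟨-, -, -, h6, -⟩ := Tlin_bounds q hq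
  have hx := succ_le_two_pow q
  have hX := big_arg_le_lin q d hq
  obtain ⟨hy, -, hqy, -⟩ := two_pow_facts q hq
  have hfac := factorial_mul_choose_sub_two_le (d + q - 3 + (q + 1) * d) q (by omega)
  have hpow := pow_le_factorial_mul_choose p q
  have h3 := choose_three_mul_le (d + q)
  have h35 := five_mul_two_pow_le_three_pow q hq
  -- `p + 1 ≥ 3(q+2)(d+q)` from `Tlin q ≥ 6(q+2)·2^q` and `d + q ≤ 2·2^q`
  have hp3 : 3 * (q + 2) * (d + q) ≤ p + 1 := by
    have h1 : d + q ≤ 2 * 2 ^ q := by omega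
    calc 3 * (q + 2) * (d + q) ≤ 3 * (q + 2) * (2 * 2 ^ q) := Nat.mul_le_mul_left _ h1
      _ = 6 * (q + 2) * 2 ^ q := by ring
      _ ≤ Tlin q := h6
      _ ≤ p := hp
      _ ≤ p + 1 := Nat.le_succ p
  -- the key inequality: `32·2^q·(d+q)^3·q(q−1)·((q+2)(d+q))^{q−2} ≤ 30·d·(p+1)^q`
  have hkey : 32 * 2 ^ q * (d + q) ^ 3 * (q * (q - 1)) * ((q + 2) * (d + q)) ^ (q - 2) ≤
      30 * d * (p + 1) ^ q := by
    obtain ⟨r, rfl⟩ : ∃ r, q = r + 2 := ⟨q - 2, by omega⟩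
    rw [show r + 2 - 2 = r by omega, show r + 2 - 1 = r + 1 by omega]
    have hpq : (3 * (r + 2 + 2) * (d + (r + 2))) ^ (r + 2) ≤ (p + 1) ^ (r + 2) := Nat.pow_le_pow_left hp3 (r + 2)
    have hc : 64 * 2 ^ (r + 2) * ((r + 2) * (r + 1)) ≤ 30 * 3 ^ (r + 2) * (r + 2 + 2) ^ 2 := by
      have h1 : (r + 2) * (r + 1) ≤ (r + 2 + 2) ^ 2 := by nlinarith
      calc 64 * 2 ^ (r + 2) * ((r + 2) * (r + 1)) ≤ 64 * 2 ^ (r + 2) * (r + 2 + 2) ^ 2 :=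
            Nat.mul_le_mul_left _ h1
        _ ≤ 30 * 3 ^ (r + 2) * (r + 2 + 2) ^ 2 := by
            have : 64 * 2 ^ (r + 2) ≤ 30 * 3 ^ (r + 2) := by omega
            exact Nat.mul_le_mul_right _ this
    have hdq : d + (r + 2) ≤ 2 * d := by omega
    calc 32 * 2 ^ (r + 2) * (d + (r + 2)) ^ 3 * ((r + 2) * (r + 1)) * ((r + 2 + 2) * (d + (r + 2))) ^ r
        = 32 * 2 ^ (r + 2) * ((r + 2) * (r + 1)) * (r + 2 + 2) ^ r * (d + (r + 2)) ^ (r + 2) *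
            (d + (r + 2)) := by rw [mul_pow]; ring
      _ ≤ 32 * 2 ^ (r + 2) * ((r + 2) * (r + 1)) * (r + 2 + 2) ^ r * (d + (r + 2)) ^ (r + 2) * (2 * d) :=
          Nat.mul_le_mul_left _ hdq
      _ = (64 * 2 ^ (r + 2) * ((r + 2) * (r + 1))) * ((r + 2 + 2) ^ r * (d + (r + 2)) ^ (r + 2)) * d := by ring
      _ ≤ (30 * 3 ^ (r + 2) * (r + 2 + 2) ^ 2) * ((r + 2 + 2) ^ r * (d + (r + 2)) ^ (r + 2)) * d :=
          Nat.mul_le_mul_right _ (Nat.mul_le_mul_right _ hc)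
      _ = 30 * d * (3 * (r + 2 + 2) * (d + (r + 2))) ^ (r + 2) := by
          rw [mul_pow, mul_pow, show (r + 2 + 2) ^ (r + 2) = (r + 2 + 2) ^ 2 * (r + 2 + 2) ^ r by
            rw [← pow_add]; ring_nf]
          ring
      _ ≤ 30 * d * (p + 1) ^ (r + 2) := Nat.mul_le_mul_left _ hpq
  -- assemble: multiply the goal by `6·q!`
  have hpos : 0 < 6 * q.factorial := by positivity
  apply Nat.le_of_mul_le_mul_right _ hpos
  set X := d + q - 3 + (q + 1) * d with hXdef
  have hXpow : X ^ (q - 2) ≤ ((q + 2) * (d + q)) ^ (q - 2) := Nat.pow_le_pow_left hX _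
  calc 32 * 2 ^ q * ((d + q).choose 3 * X.choose (q - 2)) * (6 * q.factorial)
      = 32 * 2 ^ q * (6 * (d + q).choose 3) * (q.factorial * X.choose (q - 2)) := by ring
    _ ≤ 32 * 2 ^ q * (d + q) ^ 3 * (q * (q - 1) * X ^ (q - 2)) :=
        Nat.mul_le_mul (Nat.mul_le_mul_left _ h3) hfac
    _ ≤ 32 * 2 ^ q * (d + q) ^ 3 * (q * (q - 1) * ((q + 2) * (d + q)) ^ (q - 2)) :=
        Nat.mul_le_mul_left _ (Nat.mul_le_mul_left _ hXpow)
    _ = 32 * 2 ^ q * (d + q) ^ 3 * (q * (q - 1)) * ((q + 2) * (d + q)) ^ (q - 2) := by ring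
    _ ≤ 30 * d * (p + 1) ^ q := hkey
    _ ≤ 30 * d * (q.factorial * (p + q).choose q) := Nat.mul_le_mul_left _ hpow
    _ = 5 * d * (p + q).choose q * (6 * q.factorial) := by ring

/-- **THE POLYNOMIAL INEQUALITY `(P_d)` OF THEOREM P⁗′** (in `ℚ`): at level `q ≥ 4`, corank `q + 1 ≤ d ≤ q + 2^q`,
`p ≥ Tlin q`, with `μ = min (2^{q−1} − q) d`, small-class weight `W_s` (`W_s·μ ≤ 2^d`), big-class weight `W_b`
(`W_b·d ≤ 2^d`), `6A ≤ 3d(d+1)·C(p+d, q−2) + 2d(d+1)(d+2)·C(p+d, q−3) + 6·C(2d+2q−2, 4)·C(2d+2q−6+(p+d), q−4)` and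
`B ≤ C(d+q, 3)·C(d+q−3+(q+1)d, q−2)`:
`8·(C(p+d, q) + W_s·A + W_b·B) ≤ 7·2^{d−q}·C(p+q, q)`. -/
theorem poly_main_lin (q d p μ : ℕ) (hq : 4 ≤ q) (hd1 : q + 1 ≤ d) (hd2 : d ≤ q + 2 ^ q)
    (hp : Tlin q ≤ p) (hμ : μ = min (2 ^ (q - 1) - q) d) (A B : ℕ) (Ws Wb : ℚ)
    (hWs : Ws * μ ≤ 2 ^ d) (hWb : Wb * d ≤ 2 ^ d)
    (hA : 6 * A ≤ 3 * (d * (d + 1)) * (p + d).choose (q - 2) + 2 * (d * (d + 1) * (d + 2)) * (p + d).choose (q - 3) +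
      6 * ((2 * d + 2 * q - 2).choose 4 * (2 * d + 2 * q - 6 + (p + d)).choose (q - 4)))
    (hB : B ≤ (d + q).choose 3 * (d + q - 3 + (q + 1) * d).choose (q - 2)) :
    8 * (((p + d).choose q : ℚ) + Ws * A + Wb * B) ≤ 7 * 2 ^ (d - q) * ((p + q).choose q : ℚ) := by
  obtain ⟨hy, hz, hqy, hqz⟩ := two_pow_facts q hq
  obtain ⟨-, h16, -, -, -⟩ := Tlin_bounds q hq
  have hx := succ_le_two_pow q
  -- (C1) the ratio bound
  have hC1 : 8 * (p + d).choose q ≤ 9 * (p + q).choose q := by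
    have hside : 8 * (2 * q * (d - q - 1 + 1)) ≤ p + 1 := by
      have := Nat.mul_le_mul (le_refl q) (show d - q - 1 + 1 ≤ 2 ^ q by omega)
      have := h16.trans hp
      nlinarith
    have := (ratio_bounds q (d - q - 1) p hside).1
    rwa [show p + q + 1 + (d - q - 1) = p + d by omega] at this
  -- (S) the small class in `ℕ`: `32·2^q·(6A) ≤ 30·μ·C`
  have hS : 32 * 2 ^ q * (6 * A) ≤ 30 * μ * (p + q).choose q := by
    have h3 := small_three_bound_lin q d p μ hq hd1 hd2 hp hμ
    have h4 := small_four_bound_lin q d p μ hq hd1 hd2 hp hμ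
    have h5 := small_five_bound_lin q d p μ hq hd1 hd2 hp hμ
    calc 32 * 2 ^ q * (6 * A)
        ≤ 32 * 2 ^ q * (3 * (d * (d + 1)) * (p + d).choose (q - 2) +
            2 * (d * (d + 1) * (d + 2)) * (p + d).choose (q - 3) +
            6 * ((2 * d + 2 * q - 2).choose 4 * (2 * d + 2 * q - 6 + (p + d)).choose (q - 4))) := Nat.mul_le_mul_left _ hA
      _ = 96 * 2 ^ q * (d * (d + 1)) * (p + d).choose (q - 2) +
            64 * 2 ^ q * (d * (d + 1) * (d + 2)) * (p + d).choose (q - 3) +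
            192 * 2 ^ q * ((2 * d + 2 * q - 2).choose 4 * (2 * d + 2 * q - 6 + (p + d)).choose (q - 4)) := by ring
      _ ≤ 10 * μ * (p + q).choose q + 10 * μ * (p + q).choose q + 10 * μ * (p + q).choose q :=
          Nat.add_le_add (Nat.add_le_add h3 h4) h5
      _ = 30 * μ * (p + q).choose q := by ring
  have hBn : 32 * 2 ^ q * B ≤ 5 * d * (p + q).choose q :=
    (Nat.mul_le_mul_left _ hB).trans (big_class_bound_lin q d p hq hd1 hd2 hp)
  -- to `ℚ`
  have hμpos : (0 : ℚ) < μ := by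
    have : 1 ≤ μ := by rw [hμ]; exact le_min (by omega) (by omega)
    exact_mod_cast this
  have hdpos : (0 : ℚ) < d := by exact_mod_cast (show 0 < d by omega)
  have hC : (0 : ℚ) ≤ ((p + q).choose q : ℚ) := Nat.cast_nonneg _
  have hC1q : 8 * ((p + d).choose q : ℚ) ≤ 9 * ((p + q).choose q : ℚ) := by exact_mod_cast hC1
  have hSq : 32 * (2 : ℚ) ^ q * (6 * A) ≤ 30 * μ * ((p + q).choose q : ℚ) := by exact_mod_cast hS
  have hBq : 32 * (2 : ℚ) ^ q * B ≤ 5 * d * ((p + q).choose q : ℚ) := by exact_mod_cast hBn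
  have h2d : (2 : ℚ) ^ d = 2 ^ q * 2 ^ (d - q) := by
    rw [← pow_add]; congr 1; omega
  have h2dq : (2 : ℚ) ≤ 2 ^ (d - q) := by
    calc (2 : ℚ) = 2 ^ 1 := by norm_num
      _ ≤ 2 ^ (d - q) := pow_le_pow_right₀ (by norm_num) (by omega)
  have hA0 : (0 : ℚ) ≤ A := Nat.cast_nonneg _
  have hB0 : (0 : ℚ) ≤ B := Nat.cast_nonneg _
  have hq0 : (0 : ℚ) < 2 ^ q := by positivity
  have hdq0 : (0 : ℚ) < 2 ^ (d - q) := by positivity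
  -- the small class: `8·Ws·A ≤ (5/4)·2^{d−q}·C`
  have hsmall : 8 * Ws * A ≤ 5 / 4 * 2 ^ (d - q) * ((p + q).choose q : ℚ) := by
    have e1 : (Ws * μ) * (8 * A) ≤ 2 ^ d * (8 * A) := mul_le_mul_of_nonneg_right hWs (by positivity)
    have e2 : 8 * (2 : ℚ) ^ q * A ≤ 5 / 4 * μ * ((p + q).choose q : ℚ) := by linarith
    have e3 : (2 : ℚ) ^ d * (8 * A) = 2 ^ (d - q) * (8 * 2 ^ q * A) := by rw [h2d]; ring
    have e4 : 2 ^ (d - q) * (8 * (2 : ℚ) ^ q * A) ≤ 2 ^ (d - q) * (5 / 4 * μ * ((p + q).choose q : ℚ)) :=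
      mul_le_mul_of_nonneg_left e2 hdq0.le
    have e5 : (8 * Ws * A) * μ ≤ (5 / 4 * 2 ^ (d - q) * ((p + q).choose q : ℚ)) * μ := by
      calc (8 * Ws * A) * μ = (Ws * μ) * (8 * A) := by ring
        _ ≤ 2 ^ d * (8 * A) := e1
        _ = 2 ^ (d - q) * (8 * 2 ^ q * A) := e3
        _ ≤ 2 ^ (d - q) * (5 / 4 * μ * ((p + q).choose q : ℚ)) := e4
        _ = (5 / 4 * 2 ^ (d - q) * ((p + q).choose q : ℚ)) * μ := by ring
    exact le_of_mul_le_mul_right e5 hμpos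
  -- the big class: `8·Wb·B ≤ (5/4)·2^{d−q}·C`
  have hbig : 8 * Wb * B ≤ 5 / 4 * 2 ^ (d - q) * ((p + q).choose q : ℚ) := by
    have e1 : (Wb * d) * (8 * B) ≤ 2 ^ d * (8 * B) := mul_le_mul_of_nonneg_right hWb (by positivity)
    have e2 : 8 * (2 : ℚ) ^ q * B ≤ 5 / 4 * d * ((p + q).choose q : ℚ) := by linarith
    have e3 : (2 : ℚ) ^ d * (8 * B) = 2 ^ (d - q) * (8 * 2 ^ q * B) := by rw [h2d]; ring
    have e4 : 2 ^ (d - q) * (8 * (2 : ℚ) ^ q * B) ≤ 2 ^ (d - q) * (5 / 4 * d * ((p + q).choose q : ℚ)) :=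
      mul_le_mul_of_nonneg_left e2 hdq0.le
    have e5 : (8 * Wb * B) * d ≤ (5 / 4 * 2 ^ (d - q) * ((p + q).choose q : ℚ)) * d := by
      calc (8 * Wb * B) * d = (Wb * d) * (8 * B) := by ring
        _ ≤ 2 ^ d * (8 * B) := e1
        _ = 2 ^ (d - q) * (8 * 2 ^ q * B) := e3
        _ ≤ 2 ^ (d - q) * (5 / 4 * d * ((p + q).choose q : ℚ)) := e4
        _ = (5 / 4 * 2 ^ (d - q) * ((p + q).choose q : ℚ)) * d := by ring
    exact le_of_mul_le_mul_right e5 hdpos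
  -- sum: `9C + (5/2)·2^{d−q}·C ≤ 7·2^{d−q}·C` as `2^{d−q} ≥ 2`
  have hsum : 9 * ((p + q).choose q : ℚ) ≤ 9 / 2 * 2 ^ (d - q) * ((p + q).choose q : ℚ) := by
    have := mul_le_mul_of_nonneg_right h2dq hC
    linarith
  linarith

end Explicit

end ThmN

end PercRepro
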